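import Summits.Ventures.CertifiedManyBodySolver.Downfold.EmeryBandReduction
import HarnessLib

/-!
# Technique B with the across-Cu oxygen hopping `t_pp′`: the four-parameter map
# `(Δ, t_pd, t_pp, t_pp′) ↦ (t, t′, t″)` as a charge-transfer shift, and its box enclosures

Venture CertifiedManyBodySolver, cell `pub/hubbard-downfold` (stage S1 = downfolding front end), seat
hubbard-downfold-mod-4; namespace `Summit.Ventures.CertifiedManyBodySolver.Downfold.Emery`. Everything
here is PROVED. WHAT THIS IS NOT: a statement about any material; no literature number here.

Three-band parameter tables of record carry a fourth one-body parameter, the O–O hopping ACROSS a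
Cu between like orbitals (`t_pp′`, Cu-4s mediated; BOX-SCHEMA token `t_pp'`). In the electron
picture and real gauge of `EmeryBlochBand.bloch` it is the diagonal term `−4 t_pp′ sx²` on `pₓ` and
`−4 t_pp′ sy²` on `p_y` (CONVENTION: `t_pp′ > 0` lowers `pₓ` at X and drives `t′` toward the cuprate
sign; the cell's kit job j256193 uses the same convention — a source with the opposite sign is
mapped by the box writer). At the four k-points this is EXACTLY a shift of the charge-transfer
energy: `Δ ↦ Δ + 4t_pp′` at X and M, `Δ ↦ Δ + 2t_pp′` at S, nothing at Γ:

* `bloch4`, `det_bloch4_X/M/S` (factorised characteristic cubics), `det_bloch4_*_ab*` (the shifted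
  closed forms `abX (Δ + 4c)`, `abM (Δ + 4c)`, `abS (Δ + 2c)` are eigenvalues) and
  `le_ab*_of_det_bloch4_eq_zero` (they are the TOP eigenvalue for `Δ ≥ 0`, `t_pp, t_pp′ ≥ 0`).
* `tB4 Δ a b c = tB (Δ + 4c) a b`, `tpB4 = tpB (Δ + 4c) a b`,
  `tppB4 = abS(Δ + 2c)/8 − abX(Δ + 4c)/16 − abM(Δ + 4c)/32` (= the four-point extraction of
  `(0, abX, abM, abS)` at the shifted arguments, `tppB4_eq_extractTpp`).
* Box enclosures on `[Δlo,Δhi] × [alo,ahi] × [blo,bhi] × [clo,chi]` (`alo ≥ 0`): `t` by corners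
  (`tB4_mem_Icc_of_box`: `t_pp′` acts like `Δ`, antitone), `t′`, `t″` by MIXED corners
  (`tpB4_mem_Icc_of_box_mixed`, `tppB4_mem_Icc_of_box_mixed`).

Sources: Andersen–Liechtenstein–Jepsen–Paulsen (1995) / Pavarini et al. (2001) four-orbital
language [PavariniEtAl2001]; parameter tables with `t_pp′`: Weber–Yee–Haule–Kotliar, EPL 100
(2012) 37001 (cited in the cell's REFVALS; numbers live there, not here).
-/

noncomputable section

namespace Summit.Ventures.CertifiedManyBodySolver.Downfold.Emery

open Real

/-! ## §1 The Bloch matrix with `t_pp′` and its antibonding energies at X, M, S -/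

/-- Three-band Bloch matrix with the across-Cu O–O hopping `t_pp′` (`c`): `EmeryBlochBand.bloch`
plus the diagonal terms `−4c·sx²` on `pₓ` and `−4c·sy²` on `p_y`. [cite: PavariniEtAl2001, Eqs. (2)–(3) (four-orbital model, O–O hopping via Cu 4s)] -/
def bloch4 (Δ tpd tpp c sx sy : ℝ) : Matrix (Fin 3) (Fin 3) ℝ :=
  !![0, 2 * tpd * sx, -2 * tpd * sy;
     2 * tpd * sx, -Δ - 4 * c * sx ^ 2, -4 * tpp * sx * sy;
     -2 * tpd * sy, -4 * tpp * sx * sy, -Δ - 4 * c * sy ^ 2]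

/-- With `c = 0` the matrix is `EmeryBlochBand.bloch`. [folklore] -/
theorem bloch4_zero (Δ tpd tpp sx sy : ℝ) : bloch4 Δ tpd tpp 0 sx sy = bloch Δ tpd tpp sx sy := by
  ext i j
  fin_cases i <;> fin_cases j <;> simp [bloch4, bloch]

/-- Characteristic determinant of `bloch4` as an explicit cubic (all k). [folklore] -/
theorem det_bloch4_sub (Δ tpd tpp c sx sy ε : ℝ) :
    (bloch4 Δ tpd tpp c sx sy - ε • (1 : Matrix (Fin 3) (Fin 3) ℝ)).det =
      (-ε) * ((-Δ - 4 * c * sx ^ 2 - ε) * (-Δ - 4 * c * sy ^ 2 - ε) - (4 * tpp * sx * sy) ^ 2)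
        - (2 * tpd * sx) * ((2 * tpd * sx) * (-Δ - 4 * c * sy ^ 2 - ε)
            - (4 * tpp * sx * sy) * (2 * tpd * sy))
        + (-2 * tpd * sy) * (-(2 * tpd * sx) * (4 * tpp * sx * sy)
            - (-Δ - 4 * c * sx ^ 2 - ε) * (-2 * tpd * sy)) := by
  simp [bloch4, Matrix.det_fin_three, Matrix.sub_apply, Matrix.smul_apply]
  ring

/-- At X (`sx = 1`, `sy = 0`): `det = (−Δ − ε)·(ε(ε + Δ + 4c) − 4t_pd²)` — the d–pₓ pair sees the
shifted charge-transfer energy `Δ + 4c`, `p_y` decouples at `−Δ`. [folklore] -/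
theorem det_bloch4_X (Δ tpd tpp c ε : ℝ) :
    (bloch4 Δ tpd tpp c 1 0 - ε • (1 : Matrix (Fin 3) (Fin 3) ℝ)).det =
      (-Δ - ε) * (ε * (ε + (Δ + 4 * c)) - 4 * tpd ^ 2) := by
  rw [det_bloch4_sub]; ring

/-- At M (`sx = sy = 1`): `det = (−(Δ+4c) − 4t_pp − ε)·(ε(ε + (Δ+4c) − 4t_pp) − 8t_pd²)` — exactly
the `t_pp′ = 0` cubic at the shifted `Δ + 4c`. [folklore] -/
theorem det_bloch4_M (Δ tpd tpp c ε : ℝ) :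
    (bloch4 Δ tpd tpp c 1 1 - ε • (1 : Matrix (Fin 3) (Fin 3) ℝ)).det =
      (-(Δ + 4 * c) - 4 * tpp - ε) * (ε * (ε + (Δ + 4 * c) - 4 * tpp) - 8 * tpd ^ 2) := by
  rw [det_bloch4_sub]; ring

/-- At S (`sx = sy = √2/2`): `det = (−(Δ+2c) − 2t_pp − ε)·(ε(ε + (Δ+2c) − 2t_pp) − 4t_pd²)` — the
`t_pp′ = 0` cubic at the shifted `Δ + 2c`. [folklore] -/
theorem det_bloch4_S (Δ tpd tpp c ε : ℝ) :
    (bloch4 Δ tpd tpp c (Real.sqrt 2 / 2) (Real.sqrt 2 / 2) - ε • (1 : Matrix (Fin 3) (Fin 3) ℝ)).det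
      = (-(Δ + 2 * c) - 2 * tpp - ε) * (ε * (ε + (Δ + 2 * c) - 2 * tpp) - 4 * tpd ^ 2) := by
  rw [det_bloch4_sub]
  have h2 : Real.sqrt 2 ^ 2 = 2 := Real.sq_sqrt (by norm_num)
  have h4 : Real.sqrt 2 ^ 4 = 4 := by nlinarith [h2]
  have h2' : (Real.sqrt 2 / 2) ^ 2 = 1 / 2 := by rw [div_pow, h2]; norm_num
  rw [h2']
  ring_nf
  rw [h2, h4]
  ring

/-- `abX (Δ + 4c) t_pd` is an eigenvalue of `bloch4` at X. [folklore] -/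
theorem det_bloch4_X_abX (Δ tpd tpp c : ℝ) :
    (bloch4 Δ tpd tpp c 1 0 - abX (Δ + 4 * c) tpd • (1 : Matrix (Fin 3) (Fin 3) ℝ)).det = 0 := by
  rw [det_bloch4_X, abX_secular]; ring

/-- `abM (Δ + 4c) t_pd t_pp` is an eigenvalue of `bloch4` at M. [folklore] -/
theorem det_bloch4_M_abM (Δ tpd tpp c : ℝ) :
    (bloch4 Δ tpd tpp c 1 1 - abM (Δ + 4 * c) tpd tpp • (1 : Matrix (Fin 3) (Fin 3) ℝ)).det = 0 := by
  rw [det_bloch4_M, abM_secular]; ring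

/-- `abS (Δ + 2c) t_pd t_pp` is an eigenvalue of `bloch4` at S. [folklore] -/
theorem det_bloch4_S_abS (Δ tpd tpp c : ℝ) :
    (bloch4 Δ tpd tpp c (Real.sqrt 2 / 2) (Real.sqrt 2 / 2)
      - abS (Δ + 2 * c) tpd tpp • (1 : Matrix (Fin 3) (Fin 3) ℝ)).det = 0 := by
  rw [det_bloch4_S, abS_secular]; ring

/-- TOP at X (`Δ ≥ 0`, `c ≥ 0`): every eigenvalue of `bloch4` at X is `≤ abX (Δ + 4c) t_pd`.
[folklore] -/
theorem le_abX_of_det_bloch4_eq_zero {Δ tpd tpp c ε : ℝ} (hΔ : 0 ≤ Δ) (hc : 0 ≤ c)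
    (h : (bloch4 Δ tpd tpp c 1 0 - ε • (1 : Matrix (Fin 3) (Fin 3) ℝ)).det = 0) :
    ε ≤ abX (Δ + 4 * c) tpd := by
  rw [det_bloch4_X] at h
  have hX := abX_nonneg (Δ + 4 * c) tpd
  rcases mul_eq_zero.mp h with h1 | h1
  · have : ε = -Δ := by linarith
    linarith
  · exact le_of_quadratic_root hX (by linarith) (abX_secular (Δ + 4 * c) tpd) (by linarith)

/-- TOP at M (`Δ, t_pp, c ≥ 0`): every eigenvalue of `bloch4` at M is `≤ abM (Δ + 4c) t_pd t_pp`.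
[folklore] -/
theorem le_abM_of_det_bloch4_eq_zero {Δ tpd tpp c ε : ℝ} (hΔ : 0 ≤ Δ) (htpp : 0 ≤ tpp) (hc : 0 ≤ c)
    (h : (bloch4 Δ tpd tpp c 1 1 - ε • (1 : Matrix (Fin 3) (Fin 3) ℝ)).det = 0) :
    ε ≤ abM (Δ + 4 * c) tpd tpp := by
  have h' : (bloch (Δ + 4 * c) tpd tpp 1 1 - ε • (1 : Matrix (Fin 3) (Fin 3) ℝ)).det = 0 := by
    rw [det_bloch_M]; rw [det_bloch4_M] at h; linarith
  exact le_abM_of_det_eq_zero (by linarith) htpp h'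

/-- TOP at S (`Δ, t_pp, c ≥ 0`): every eigenvalue of `bloch4` at S is `≤ abS (Δ + 2c) t_pd t_pp`.
[folklore] -/
theorem le_abS_of_det_bloch4_eq_zero {Δ tpd tpp c ε : ℝ} (hΔ : 0 ≤ Δ) (htpp : 0 ≤ tpp) (hc : 0 ≤ c)
    (h : (bloch4 Δ tpd tpp c (Real.sqrt 2 / 2) (Real.sqrt 2 / 2)
      - ε • (1 : Matrix (Fin 3) (Fin 3) ℝ)).det = 0) :
    ε ≤ abS (Δ + 2 * c) tpd tpp := by
  have h' : (bloch (Δ + 2 * c) tpd tpp (Real.sqrt 2 / 2) (Real.sqrt 2 / 2)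
      - ε • (1 : Matrix (Fin 3) (Fin 3) ℝ)).det = 0 := by
    rw [det_bloch_S]; rw [det_bloch4_S] at h; linarith
  exact le_abS_of_det_eq_zero (by linarith) htpp h'

/-! ## §2 The four-parameter map and its box enclosures -/

/-- Technique-B `t` with `t_pp′`: `t_B(Δ + 4c, t_pd, t_pp)`. [folklore] -/
def tB4 (Δ tpd tpp c : ℝ) : ℝ := tB (Δ + 4 * c) tpd tpp

/-- Technique-B `t′` with `t_pp′`: `t′_B(Δ + 4c, t_pd, t_pp)` (X and M both see `Δ + 4c`). [folklore] -/
def tpB4 (Δ tpd tpp c : ℝ) : ℝ := tpB (Δ + 4 * c) tpd tpp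

/-- Technique-B `t″` with `t_pp′`: `abS(Δ + 2c)/8 − abX(Δ + 4c)/16 − abM(Δ + 4c)/32` (S sees
`Δ + 2c`). [folklore] -/
def tppB4 (Δ tpd tpp c : ℝ) : ℝ :=
  abS (Δ + 2 * c) tpd tpp / 8 - abX (Δ + 4 * c) tpd / 16 - abM (Δ + 4 * c) tpd tpp / 32

/-- `t″` with `t_pp′` is the four-point extraction at the shifted antibonding energies. [folklore] -/
theorem tppB4_eq_extractTpp (Δ tpd tpp c : ℝ) :
    tppB4 Δ tpd tpp c =
      extractTpp 0 (abX (Δ + 4 * c) tpd) (abM (Δ + 4 * c) tpd tpp) (abS (Δ + 2 * c) tpd tpp) := by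
  simp only [tppB4, extractTpp, extractTp]; ring

/-- With `c = 0` the four-parameter map is the three-parameter one. [folklore] -/
theorem tB4_zero (Δ tpd tpp : ℝ) :
    tB4 Δ tpd tpp 0 = tB Δ tpd tpp ∧ tpB4 Δ tpd tpp 0 = tpB Δ tpd tpp ∧
      tppB4 Δ tpd tpp 0 = tppB Δ tpd tpp := by
  refine ⟨by simp [tB4], by simp [tpB4], ?_⟩
  rw [tppB4, tppB_eq]; simp

/-- **CORNER ENCLOSURE for `t` with `t_pp′`** (`alo ≥ 0`; `t_pp′` acts like `Δ`: antitone):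
`t ∈ [t_B(Δhi + 4chi, alo, blo), t_B(Δlo + 4clo, ahi, bhi)]`. [folklore] -/
theorem tB4_mem_Icc_of_box {Δlo Δhi alo ahi blo bhi clo chi Δ tpd tpp c : ℝ} (ha : 0 ≤ alo)
    (hΔ : Δ ∈ Set.Icc Δlo Δhi) (htpd : tpd ∈ Set.Icc alo ahi) (htpp : tpp ∈ Set.Icc blo bhi)
    (hc : c ∈ Set.Icc clo chi) :
    tB4 Δ tpd tpp c ∈ Set.Icc (tB (Δhi + 4 * chi) alo blo) (tB (Δlo + 4 * clo) ahi bhi) := by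
  have hΔ' : Δ + 4 * c ∈ Set.Icc (Δlo + 4 * clo) (Δhi + 4 * chi) :=
    ⟨by linarith [hΔ.1, hc.1], by linarith [hΔ.2, hc.2]⟩
  exact tB_mem_Icc_of_box ha hΔ' htpd htpp

/-- **MIXED-CORNER ENCLOSURE for `t′` with `t_pp′`** (`alo ≥ 0`):
`t′ ∈ [(2·abX(Δhi+4chi, alo) − abM(Δlo+4clo, ahi, bhi))/16,
       (2·abX(Δlo+4clo, ahi) − abM(Δhi+4chi, alo, blo))/16]`. [folklore] -/
theorem tpB4_mem_Icc_of_box_mixed {Δlo Δhi alo ahi blo bhi clo chi Δ tpd tpp c : ℝ} (ha : 0 ≤ alo)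
    (hΔ : Δ ∈ Set.Icc Δlo Δhi) (htpd : tpd ∈ Set.Icc alo ahi) (htpp : tpp ∈ Set.Icc blo bhi)
    (hc : c ∈ Set.Icc clo chi) :
    tpB4 Δ tpd tpp c ∈ Set.Icc ((2 * abX (Δhi + 4 * chi) alo - abM (Δlo + 4 * clo) ahi bhi) / 16)
      ((2 * abX (Δlo + 4 * clo) ahi - abM (Δhi + 4 * chi) alo blo) / 16) := by
  have hΔ' : Δ + 4 * c ∈ Set.Icc (Δlo + 4 * clo) (Δhi + 4 * chi) :=
    ⟨by linarith [hΔ.1, hc.1], by linarith [hΔ.2, hc.2]⟩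
  exact tpB_mem_Icc_of_box_mixed ha hΔ' htpd htpp

/-- **MIXED-CORNER ENCLOSURE for `t″` with `t_pp′`** (`alo ≥ 0`; S shifted by `2c`, X and M by `4c`):
`t″ ∈ [abS(Δhi+2chi,alo,blo)/8 − abX(Δlo+4clo,ahi)/16 − abM(Δlo+4clo,ahi,bhi)/32,
       abS(Δlo+2clo,ahi,bhi)/8 − abX(Δhi+4chi,alo)/16 − abM(Δhi+4chi,alo,blo)/32]`. [folklore] -/
theorem tppB4_mem_Icc_of_box_mixed {Δlo Δhi alo ahi blo bhi clo chi Δ tpd tpp c : ℝ} (ha : 0 ≤ alo)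
    (hΔ : Δ ∈ Set.Icc Δlo Δhi) (htpd : tpd ∈ Set.Icc alo ahi) (htpp : tpp ∈ Set.Icc blo bhi)
    (hc : c ∈ Set.Icc clo chi) :
    tppB4 Δ tpd tpp c ∈ Set.Icc
      (abS (Δhi + 2 * chi) alo blo / 8 - abX (Δlo + 4 * clo) ahi / 16
        - abM (Δlo + 4 * clo) ahi bhi / 32)
      (abS (Δlo + 2 * clo) ahi bhi / 8 - abX (Δhi + 4 * chi) alo / 16
        - abM (Δhi + 4 * chi) alo blo / 32) := by
  have hΔ4 : Δ + 4 * c ∈ Set.Icc (Δlo + 4 * clo) (Δhi + 4 * chi) :=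
    ⟨by linarith [hΔ.1, hc.1], by linarith [hΔ.2, hc.2]⟩
  have hΔ2 : Δ + 2 * c ∈ Set.Icc (Δlo + 2 * clo) (Δhi + 2 * chi) :=
    ⟨by linarith [hΔ.1, hc.1], by linarith [hΔ.2, hc.2]⟩
  have hX := abX_mem_Icc_of_box ha hΔ4 htpd
  have hM := abM_mem_Icc_of_box ha hΔ4 htpd htpp
  have hS := abS_mem_Icc_of_box ha hΔ2 htpd htpp
  unfold tppB4
  exact ⟨by linarith [hX.2, hM.2, hS.1], by linarith [hX.1, hM.1, hS.2]⟩

/-- `t > 0` with `t_pp′` as soon as `t_pd ≠ 0`. [folklore] -/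
theorem tB4_pos {Δ tpd tpp c : ℝ} (htpd : tpd ≠ 0) : 0 < tB4 Δ tpd tpp c := tB_pos htpd

/-- `t′` with `t_pp′` is ANTITONE in `t_pp` (the sign mechanism persists). [folklore] -/
theorem tpB4_anti_tpp {Δ tpd tpp₁ tpp₂ c : ℝ} (h : tpp₁ ≤ tpp₂) :
    tpB4 Δ tpd tpp₂ c ≤ tpB4 Δ tpd tpp₁ c := tpB_anti_tpp h

end Summit.Ventures.CertifiedManyBodySolver.Downfold.Emery

end
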